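import Mathlib
import Literature.Barriers.ValiantsHypothesis.MonotoneGapDecomposition
import Literature.Barriers.ValiantsHypothesis.MonotoneGapParseTrees
import Literature.Computability.AlgebraicComplexity.ArithCircuitProofs

/-!
# `DivisionGap.PerMultiplesHard` (stmt-ValiantsHypothesis-5068), line `uncharged-face-walk`:
stub `stub_linkCircuit` — the complement factor of a peel is computed by a linear-size circuit

Constructive form of `exists_eval_eq_zeroAt_add` (`MonotoneGapDecomposition.lean`): for a
fan-in-two circuit `P` over a commutative semiring and a gate index `v` there is a fan-in-two
circuit `Q` with `5 · P.size` gates and `P.eval = (P.zeroAt v).eval + p_v · Q.eval`,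
`p_v = (gateValues P.gates).getD v 0`.  Gate `w` of `P` becomes a block of five gates at
positions `5 w, …, 5 w + 4`: two auxiliary products, the old value `x_w`, the new value `x'_w`
(gate `v` zeroed) and a *link* `h_w` with `x_w = x'_w + p_v · h_w` (`h_v = 1`; for a sum
`Σ cᵢ uᵢ`: `Σ cᵢ h(uᵢ)`; for a product `u₀ u₁`: `h(u₀) u₁ + u₀' h(u₁)`; inputs, constants and junk
references have link `0`).  Operands are relocated by `gate j ↦ gate (5 j + 2 / 3 / 4)`; a junk
(forward) reference stays junk.  No global definitions: the relocation maps `E`, `H`, the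
operand-wise gate map `M` and the block map `B` are arbitrary functions satisfying their
defining equations (section `Maps`), instantiated by pattern matching in the deciding theorem.

-- adapted from Summits/ValiantsHypothesis/ValiantsHypothesis/Cruxes/PerMultiplesHard/Disproof.lean
-- (namespace `…Disproof.DivX`, "dividing a circuit by a variable costs a factor 8")
-/

noncomputable section

-- the namespace is mandated by the crux (`Summit.ValiantsHypothesis.ValiantsHypothesis.…`)
set_option linter.dupNamespace false

open MvPolynomial Literature.Computability.AlgebraicComplexity
open Literature.Computability.AlgebraicComplexity.ArithCircuit
open Literature.Barriers.ValiantsHypothesis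
open scoped NNReal

namespace Summit.ValiantsHypothesis.ValiantsHypothesis.Theorems.DivisionGap.PerMultiplesHard.LinkCircuit

variable {k : Type*} [CommSemiring k] {σ : Type*}

/-- Reading position `5 j + t` (`t < 5`) of a list of length `5 n` is not affected by appending
at most `t` further entries. [folklore] -/
theorem getD_append_block {α : Type*} {W L : List α} {d : α} {n t : ℕ} (hW : W.length = 5 * n)
    (ht : t < 5) (hL : L.length ≤ t) (j : ℕ) :
    (W ++ L).getD (5 * j + t) d = W.getD (5 * j + t) d := by
  by_cases hj : 5 * j + t < W.length
  · exact List.getD_append _ _ _ _ hj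
  · rw [List.getD_eq_default _ _ (by rw [List.length_append]; omega),
      List.getD_eq_default _ _ (by omega)]

/-- Reading position `5 j + t` after a block of five entries has been appended to a list of
length `5 n`. [folklore] -/
theorem getD_append_block_cases {α : Type*} {W L : List α} {d : α} {n t : ℕ}
    (hW : W.length = 5 * n) (hL : L.length = 5) (ht : t < 5) (j : ℕ) :
    (W ++ L).getD (5 * j + t) d =
      if j < n then W.getD (5 * j + t) d else if j = n then L.getD t d else d := by
  split_ifs with h₁ h₂
  · exact List.getD_append _ _ _ _ (by omega)
  · subst h₂
    rw [List.getD_append_right _ _ _ _ (by omega), hW, Nat.add_sub_cancel_left]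
  · rw [List.getD_eq_default _ _ (by rw [List.length_append]; omega)]

/-- Reading a list with one appended entry. [folklore] -/
theorem getD_append_singleton_cases {α : Type*} (l : List α) (x d : α) (j : ℕ) :
    (l ++ [x]).getD j d =
      if j < l.length then l.getD j d else if j = l.length then x else d := by
  split_ifs with h₁ h₂
  · exact List.getD_append _ _ _ _ h₁
  · subst h₂
    rw [List.getD_append_right _ _ _ _ le_rfl, Nat.sub_self, List.getD_cons_zero]
  · rw [List.getD_eq_default _ _ (by rw [List.length_append, List.length_singleton]; omega)]

/-- The product rule of the peel: if `a = a' + p η₀` and `b = b' + p η₁` then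
`a b = a' b' + p (η₀ b + a' η₁)`. [folklore] -/
theorem mul_link {R : Type*} [CommSemiring R] {a a' b b' p η₀ η₁ : R} (ha : a = a' + p * η₀)
    (hb : b = b' + p * η₁) : a * b = a' * b' + p * (η₀ * b + a' * η₁) := by
  subst ha hb; ring

/-- Five gates appended to a gate list are evaluated one after the other. [folklore] -/
theorem gateValues_append_five {G : List (Gate k σ)} {W : List (MvPolynomial σ k)}
    (hG : gateValues G = W) {g₀ g₁ g₂ g₃ g₄ : Gate k σ} {y₀ y₁ y₂ y₃ y₄ : MvPolynomial σ k}
    (h₀ : g₀.eval W = y₀) (h₁ : g₁.eval (W ++ [y₀]) = y₁) (h₂ : g₂.eval (W ++ [y₀, y₁]) = y₂)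
    (h₃ : g₃.eval (W ++ [y₀, y₁, y₂]) = y₃) (h₄ : g₄.eval (W ++ [y₀, y₁, y₂, y₃]) = y₄) :
    gateValues (G ++ [g₀, g₁, g₂, g₃, g₄]) = W ++ [y₀, y₁, y₂, y₃, y₄] := by
  have e : G ++ [g₀, g₁, g₂, g₃, g₄] = G ++ [g₀] ++ [g₁] ++ [g₂] ++ [g₃] ++ [g₄] := by simp
  rw [e, gateValues_append_singleton, gateValues_append_singleton, gateValues_append_singleton,
    gateValues_append_singleton, gateValues_append_singleton, hG, h₀]
  simp only [List.append_assoc, List.cons_append, List.nil_append]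
  rw [h₁, h₂, h₃, h₄]

/-- A product gate of fan-in at most two is the product of its first two operands, missing
operands counting as the constant `1`. [folklore] -/
theorem eval_prod_getD (vals : List (MvPolynomial σ k)) {args : List (Operand k σ)}
    (h : args.length ≤ 2) : (Gate.prod args).eval vals =
      (args.getD 0 (.const 1)).eval vals * (args.getD 1 (.const 1)).eval vals := by
  rcases args with _ | ⟨a, _ | ⟨b, _ | ⟨c, rest⟩⟩⟩ <;>
    first | (simp only [List.length_cons] at h; omega) | simp [Gate.eval, Operand.eval]

/-- Zeroing gate `v` of `gs ++ [g]`: the values of `gs` with gate `v` zeroed, followed by `0` if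
`g` is the zeroed gate and by the value of `g` against the new values otherwise.
[cite: JerrumSnir1982, §3.1 (Lemma 3.1(iii))] -/
theorem gateValues_set_snoc (gs : List (Gate k σ)) (g : Gate k σ) (v : ℕ) :
    gateValues ((gs ++ [g]).set v zeroGate) = gateValues (gs.set v zeroGate) ++
      [if gs.length = v then 0 else g.eval (gateValues (gs.set v zeroGate))] := by
  rcases Nat.lt_trichotomy v gs.length with hv | hv | hv
  · rw [List.set_append_left _ _ hv, gateValues_append_singleton, if_neg (by omega)]
  · subst hv
    rw [List.set_append_right _ _ le_rfl, Nat.sub_self, List.set_cons_zero,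
      gateValues_append_singleton, List.set_eq_of_length_le le_rfl, if_pos rfl]
    simp [zeroGate, Gate.eval]
  · rw [List.set_eq_of_length_le (by rw [List.length_append, List.length_singleton]; omega),
      List.set_eq_of_length_le (by omega), gateValues_append_singleton, if_neg (by omega)]

section Maps

variable {E : ℕ → Operand k σ → Operand k σ} {H : Operand k σ → Operand k σ}
  {M : (Operand k σ → Operand k σ) → Gate k σ → Gate k σ} {v : ℕ}
  {B : ℕ → Gate k σ → List (Gate k σ)}
  (hEv : ∀ (t : ℕ) (i : σ), E t (.var i) = .var i)
  (hEc : ∀ (t : ℕ) (c : k), E t (.const c) = .const c)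
  (hEg : ∀ (t j : ℕ), E t (.gate j) = .gate (5 * j + t))
  (hHv : ∀ i : σ, H (.var i) = .const 0)
  (hHc : ∀ c : k, H (.const c) = .const 0)
  (hHg : ∀ j : ℕ, H (.gate j) = .gate (5 * j + 4))
  (hMs : ∀ (f : Operand k σ → Operand k σ) (args : List (k × Operand k σ)),
    M f (.sum args) = .sum (args.map fun a => (a.1, f a.2)))
  (hMp : ∀ (f : Operand k σ → Operand k σ) (args : List (Operand k σ)),
    M f (.prod args) = .prod (args.map f))
  (hBs : ∀ (w : ℕ) (args : List (k × Operand k σ)), B w (.sum args) =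
    [zeroGate, zeroGate, M (E 2) (.sum args), (if w = v then zeroGate else M (E 3) (.sum args)),
      (if w = v then .sum [(1, .const 1)] else .sum (args.map fun a => (a.1, H a.2)))])
  (hBp : ∀ (w : ℕ) (args : List (Operand k σ)), B w (.prod args) =
    [.prod [H (args.getD 0 (.const 1)), E 2 (args.getD 1 (.const 1))],
      .prod [E 3 (args.getD 0 (.const 1)), H (args.getD 1 (.const 1))],
      M (E 2) (.prod args), (if w = v then zeroGate else M (E 3) (.prod args)),
      (if w = v then .sum [(1, .const 1)]
        else .sum [(1, .gate (5 * w)), (1, .gate (5 * w + 1))])])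

include hEv hEc hEg in
/-- The relocated operand `E t u` reads, at the positions `5 j + t`, the values `vals` of the
original operand `u`. [folklore] -/
theorem eval_E {t : ℕ} {W vals : List (MvPolynomial σ k)}
    (hA : ∀ j, W.getD (5 * j + t) 0 = vals.getD j 0) (u : Operand k σ) :
    (E t u).eval W = u.eval vals := by
  cases u with
  | var i => rw [hEv]; rfl
  | const c => rw [hEc]; rfl
  | gate j => rw [hEg, Operand.eval_gate, Operand.eval_gate, hA]

include hHv hHc hHg in
/-- The link operand `H u` reads an `η` with `u(vals) = u(vals') + p · η`: zero for inputs and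
constants, the link at position `5 j + 4` for a reference to gate `j`.
[cite: JerrumSnir1982, §3.1 (Lemma 3.1(iii))] -/
theorem eval_H {W vals vals' : List (MvPolynomial σ k)} {p : MvPolynomial σ k}
    (hA : ∀ j, vals.getD j 0 = vals'.getD j 0 + p * W.getD (5 * j + 4) 0) (u : Operand k σ) :
    u.eval vals = u.eval vals' + p * (H u).eval W := by
  cases u with
  | var i => rw [hHv]; simp [Operand.eval]
  | const c => rw [hHc]; simp [Operand.eval]
  | gate j => rw [hHg, Operand.eval_gate, Operand.eval_gate, Operand.eval_gate]; exact hA j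

include hMs hMp in
/-- Relocating the operands of a gate relocates its value. [folklore] -/
theorem eval_M {f : Operand k σ → Operand k σ} {W vals : List (MvPolynomial σ k)}
    (hf : ∀ u, (f u).eval W = u.eval vals) (g : Gate k σ) : (M f g).eval W = g.eval vals := by
  cases g with
  | sum args => rw [hMs]; simp [Gate.eval, List.map_map, Function.comp_def, hf]
  | prod args => rw [hMp]; simp [Gate.eval, List.map_map, Function.comp_def, hf]

/-- Sums are linear in the link: if every operand satisfies `u(vals) = u(vals') + p · (H u)(W)`
then `Σ cᵢ uᵢ(vals) = Σ cᵢ uᵢ(vals') + p · Σ cᵢ (H uᵢ)(W)`.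
[cite: JerrumSnir1982, §3.1 (Lemma 3.1(iii))] -/
theorem eval_sum_link {W vals vals' : List (MvPolynomial σ k)} {p : MvPolynomial σ k}
    (hA : ∀ u : Operand k σ, u.eval vals = u.eval vals' + p * (H u).eval W)
    (args : List (k × Operand k σ)) :
    (Gate.sum args).eval vals = (Gate.sum args).eval vals' +
      p * (Gate.sum (args.map fun a => (a.1, H a.2))).eval W := by
  induction args with
  | nil => simp [Gate.eval]
  | cons a args ih =>
    simp only [Gate.eval, List.map_cons, List.sum_cons] at ih ⊢
    rw [hA a.2, ih]
    simp only [MvPolynomial.smul_eq_C_mul]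
    ring

include hMs hMp hBs hBp in
/-- Every gate of a block has fan-in at most two (if the original gate has). [folklore] -/
theorem fanIn_of_mem_B {w : ℕ} {g g' : Gate k σ} (hg : g.fanIn ≤ 2) (h : g' ∈ B w g) :
    g'.fanIn ≤ 2 := by
  have h0 : (zeroGate : Gate k σ).fanIn ≤ 2 := by simp
  cases g with
  | sum args =>
    have hM : ∀ f, (M f (.sum args)).fanIn ≤ 2 := fun f => by
      rw [hMs]; simpa [Gate.fanIn, Gate.args] using hg
    have hs : (Gate.sum (args.map fun a => (a.1, H a.2))).fanIn ≤ 2 := by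
      simpa [Gate.fanIn, Gate.args] using hg
    rw [hBs] at h
    simp only [List.mem_cons, List.not_mem_nil, or_false] at h
    rcases h with rfl | rfl | rfl | rfl | rfl <;> (try split_ifs) <;>
      first | exact h0 | exact hM _ | exact hs | simp [Gate.fanIn, Gate.args]
  | prod args =>
    have hM : ∀ f, (M f (.prod args)).fanIn ≤ 2 := fun f => by
      rw [hMp]; simpa [Gate.fanIn, Gate.args] using hg
    rw [hBp] at h
    simp only [List.mem_cons, List.not_mem_nil, or_false] at h
    rcases h with rfl | rfl | rfl | rfl | rfl <;> (try split_ifs) <;>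
      first | exact h0 | exact hM _ | simp [Gate.fanIn, Gate.args]

include hEv hEc hEg hHv hHc hHg hMs hMp hBs hBp in
/-- **One block.** If the values `W` computed so far (`|W| = 5 w`) carry the old values `vals` at
the positions `5 j + 2`, the new values `vals'` at `5 j + 3` and links at `5 j + 4`, then the
block of gate `g` (number `w`) appends `[t₁, t₂, g(vals), x', h]` with `x' = g(vals')` (`0` if
`w = v`) and `g(vals) = x' + p · h`. [cite: JerrumSnir1982, §3.1 (Lemma 3.1(iii))] -/
theorem block_step {W vals vals' : List (MvPolynomial σ k)} {p : MvPolynomial σ k} {w : ℕ}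
    (hw : W.length = 5 * w)
    (hA2 : ∀ j, W.getD (5 * j + 2) 0 = vals.getD j 0)
    (hA3 : ∀ j, W.getD (5 * j + 3) 0 = vals'.getD j 0)
    (hA4 : ∀ j, vals.getD j 0 = vals'.getD j 0 + p * W.getD (5 * j + 4) 0)
    {G : List (Gate k σ)} (hG : gateValues G = W) {g : Gate k σ} (hg : g.fanIn ≤ 2)
    (hpv : w = v → g.eval vals = p) :
    ∃ t₁ t₂ h : MvPolynomial σ k, gateValues (G ++ B w g) =
        W ++ [t₁, t₂, g.eval vals, (if w = v then 0 else g.eval vals'), h] ∧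
      g.eval vals = (if w = v then 0 else g.eval vals') + p * h := by
  have R2 : ∀ L : List (MvPolynomial σ k), L.length ≤ 2 → ∀ u : Operand k σ,
      (E 2 u).eval (W ++ L) = u.eval vals := fun L hL u =>
    eval_E hEv hEc hEg (fun j => by rw [getD_append_block hw (by norm_num) hL]; exact hA2 j) u
  have R3 : ∀ L : List (MvPolynomial σ k), L.length ≤ 3 → ∀ u : Operand k σ,
      (E 3 u).eval (W ++ L) = u.eval vals' := fun L hL u =>
    eval_E hEv hEc hEg (fun j => by rw [getD_append_block hw (by norm_num) hL]; exact hA3 j) u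
  have R4 : ∀ L : List (MvPolynomial σ k), L.length ≤ 4 → ∀ u : Operand k σ,
      u.eval vals = u.eval vals' + p * (H u).eval (W ++ L) := fun L hL u =>
    eval_H hHv hHc hHg (fun j => by rw [getD_append_block hw (by norm_num) hL]; exact hA4 j) u
  have RX : ∀ L : List (MvPolynomial σ k), L.length ≤ 2 →
      (M (E 2) g).eval (W ++ L) = g.eval vals := fun L hL => eval_M hMs hMp (R2 L hL) g
  have RX' : ∀ L : List (MvPolynomial σ k), L.length ≤ 3 →
      (if w = v then zeroGate else M (E 3) g).eval (W ++ L) =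
        if w = v then 0 else g.eval vals' := by
    intro L hL
    split_ifs
    · simp [zeroGate, Gate.eval]
    · exact eval_M hMs hMp (R3 L hL) g
  have h1 : ∀ L : List (MvPolynomial σ k),
      (Gate.sum [((1 : k), Operand.const (1 : k))] : Gate k σ).eval L = 1 := fun L => by
    simp [Gate.eval, Operand.eval]
  have hz : ∀ L : List (MvPolynomial σ k), (zeroGate : Gate k σ).eval L = 0 := fun L => by
    simp [zeroGate, Gate.eval]
  cases g with
  | sum args =>
    rw [hBs]
    by_cases hwv : w = v
    · simp only [if_pos hwv] at RX' ⊢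
      refine ⟨0, 0, 1, gateValues_append_five hG (hz _) (hz _) (RX _ (by simp)) (RX' _ (by simp))
        (h1 _), ?_⟩
      rw [hpv hwv, zero_add, mul_one]
    · simp only [if_neg hwv] at RX' ⊢
      exact ⟨0, 0, _, gateValues_append_five hG (hz _) (hz _) (RX _ (by simp)) (RX' _ (by simp))
        rfl, eval_sum_link (R4 _ (by simp)) args⟩
  | prod args =>
    rw [hBp]
    have hlen : args.length ≤ 2 := by simpa [Gate.fanIn, Gate.args] using hg
    have ha := R4 [] (by simp) (args.getD 0 (.const 1))
    rw [List.append_nil] at ha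
    have e0 : (Gate.prod [H (args.getD 0 (.const 1)), E 2 (args.getD 1 (.const 1))]).eval W =
        (H (args.getD 0 (.const 1))).eval W * (args.getD 1 (.const 1)).eval vals := by
      have h := R2 [] (by simp) (args.getD 1 (.const 1))
      rw [List.append_nil] at h
      simp only [Gate.eval, List.map_cons, List.map_nil, List.prod_cons, List.prod_nil, mul_one, h]
    set t₁ := (H (args.getD 0 (.const 1))).eval W * (args.getD 1 (.const 1)).eval vals with ht₁
    have hb := R4 [t₁] (by simp) (args.getD 1 (.const 1))
    have e1 : (Gate.prod [E 3 (args.getD 0 (.const 1)), H (args.getD 1 (.const 1))]).eval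
        (W ++ [t₁]) =
        (args.getD 0 (.const 1)).eval vals' * (H (args.getD 1 (.const 1))).eval (W ++ [t₁]) := by
      simp only [Gate.eval, List.map_cons, List.map_nil, List.prod_cons, List.prod_nil, mul_one,
        R3 [t₁] (by simp)]
    set t₂ := (args.getD 0 (.const 1)).eval vals' * (H (args.getD 1 (.const 1))).eval (W ++ [t₁])
      with ht₂
    have R0 : ∀ (a : MvPolynomial σ k) (L : List (MvPolynomial σ k)),
        (Operand.gate (5 * w) : Operand k σ).eval (W ++ a :: L) = a := fun a L => by
      rw [Operand.eval_gate, List.getD_append_right _ _ _ _ hw.le, hw, Nat.sub_self,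
        List.getD_cons_zero]
    have R1 : ∀ (a b : MvPolynomial σ k) (L : List (MvPolynomial σ k)),
        (Operand.gate (5 * w + 1) : Operand k σ).eval (W ++ a :: b :: L) = b := fun a b L => by
      rw [Operand.eval_gate, List.getD_append_right _ _ _ _ (by omega), hw, Nat.add_sub_cancel_left]
      rfl
    by_cases hwv : w = v
    · simp only [if_pos hwv] at RX' ⊢
      refine ⟨t₁, t₂, 1, gateValues_append_five hG e0 e1 (RX _ (by simp)) (RX' _ (by simp)) (h1 _),
        ?_⟩
      rw [hpv hwv, zero_add, mul_one]
    · simp only [if_neg hwv] at RX' ⊢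
      refine ⟨t₁, t₂, t₁ + t₂, gateValues_append_five hG e0 e1 (RX _ (by simp)) (RX' _ (by simp))
        ?_, ?_⟩
      · simp only [Gate.eval, List.map_cons, List.map_nil, List.sum_cons, List.sum_nil, add_zero,
          one_smul, R0, R1]
      · rw [eval_prod_getD vals hlen, eval_prod_getD vals' hlen]
        exact mul_link ha hb

include hEv hEc hEg hHv hHc hHg hMs hMp hBs hBp in
/-- **The block circuit carries old values, new values and links.** For a fan-in-two gate list
`gs`, `(gs.mapIdx B).flatten` has `5 |gs|` gates and its values carry, at the positions
`5 j + 2`, `5 j + 3`, `5 j + 4`, the value `x_j` of gate `j` of `gs`, the value `x'_j` of gate `j`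
of `gs` with gate `v` zeroed, and a link `h_j` with `x_j = x'_j + p · h_j`, provided `p` is the
value of gate `v` (if in range). [cite: JerrumSnir1982, §3.1 (Lemma 3.1(iii))] -/
theorem link_invariant (p : MvPolynomial σ k) (gs : List (Gate k σ))
    (h2 : ∀ g ∈ gs, g.fanIn ≤ 2) (hp : v < gs.length → (gateValues gs).getD v 0 = p) :
    ((gs.mapIdx B).flatten).length = 5 * gs.length ∧
    (∀ j, (gateValues (gs.mapIdx B).flatten).getD (5 * j + 2) 0 = (gateValues gs).getD j 0) ∧
    (∀ j, (gateValues (gs.mapIdx B).flatten).getD (5 * j + 3) 0 =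
      (gateValues (gs.set v zeroGate)).getD j 0) ∧
    (∀ j, (gateValues gs).getD j 0 = (gateValues (gs.set v zeroGate)).getD j 0 +
      p * (gateValues (gs.mapIdx B).flatten).getD (5 * j + 4) 0) := by
  induction gs using List.reverseRecOn with
  | nil => simp [gateValues]
  | append_singleton gs g ih =>
    have h2' : ∀ g' ∈ gs, g'.fanIn ≤ 2 := fun g' hg' => h2 g' (List.mem_append_left _ hg')
    have hg : g.fanIn ≤ 2 := h2 g (List.mem_append_right _ List.mem_cons_self)
    have hB5 : (B gs.length g).length = 5 := by cases g <;> simp [hBs, hBp]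
    rw [List.mapIdx_concat, List.flatten_append, List.flatten_singleton,
      gateValues_append_singleton, gateValues_set_snoc]
    set vals := gateValues gs
    set vals' := gateValues (gs.set v zeroGate) with hvals'
    set W := gateValues (gs.mapIdx B).flatten with hW
    have hvl : vals.length = gs.length := gateValues_length gs
    have hvl' : vals'.length = gs.length := by rw [hvals', gateValues_length, List.length_set]
    have hp' : v < gs.length → vals.getD v 0 = p := fun hv => by
      have h := hp (by rw [List.length_append, List.length_singleton]; omega)
      rwa [gateValues_append_singleton, List.getD_append _ _ _ _ (by rw [hvl]; exact hv)] at h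
    obtain ⟨hlen, hA2, hA3, hA4⟩ := ih h2' hp'
    have hWn : W.length = 5 * gs.length := by rw [hW, gateValues_length, hlen]
    have hpv : gs.length = v → g.eval vals = p := fun hgv => by
      have h := hp (by rw [List.length_append, List.length_singleton]; omega)
      rw [gateValues_append_singleton, List.getD_append_right _ _ _ _ (by rw [hvl, hgv]), hvl, hgv,
        Nat.sub_self, List.getD_cons_zero] at h
      exact h
    obtain ⟨t₁, t₂, h, hblock, hxh⟩ :=
      block_step hEv hEc hEg hHv hHc hHg hMs hMp hBs hBp hWn hA2 hA3 hA4 hW.symm hg hpv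
    generalize (if gs.length = v then (0 : MvPolynomial σ k) else g.eval vals') = x' at hblock hxh ⊢
    rw [hblock]
    refine ⟨?_, fun j => ?_, fun j => ?_, fun j => ?_⟩
    · rw [List.length_append, hlen, hB5, List.length_append, List.length_singleton]
      ring
    · rw [getD_append_block_cases hWn rfl (by norm_num), getD_append_singleton_cases, hvl]
      split_ifs; exacts [hA2 j, rfl, rfl]
    · rw [getD_append_block_cases hWn rfl (by norm_num), getD_append_singleton_cases, hvl']
      split_ifs; exacts [hA3 j, rfl, rfl]
    · rw [getD_append_block_cases hWn rfl (by norm_num), getD_append_singleton_cases,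
        getD_append_singleton_cases, hvl, hvl']
      split_ifs; exacts [hA4 j, hxh, by simp]

end Maps

/-- **The link circuit** (constructive form of `exists_eval_eq_zeroAt_add`): for a fan-in-two
circuit `P` and a gate index `v` there is a fan-in-two circuit `Q` of size `5 · P.size` with
`P.eval = (P.zeroAt v).eval + p_v · Q.eval`, `p_v` the value of gate `v` of `P`.
[cite: JerrumSnir1982, §3.1 (Lemma 3.1(iii))] -/
theorem exists_linkCircuit (P : ArithCircuit k σ) (v : ℕ) (hP : P.IsFanInTwo) :
    ∃ Q : ArithCircuit k σ, Q.IsFanInTwo ∧ Q.size ≤ 8 * P.size + 8 ∧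
      P.eval = (P.zeroAt v).eval + (gateValues P.gates).getD v 0 * Q.eval := by
  -- the relocation maps and the blocks, by pattern matching (local, no global definitions)
  let E : ℕ → Operand k σ → Operand k σ := fun t u => match u with
    | .var i => .var i | .const c => .const c | .gate j => .gate (5 * j + t)
  let H : Operand k σ → Operand k σ := fun u => match u with
    | .gate j => .gate (5 * j + 4) | _ => .const 0
  let M : (Operand k σ → Operand k σ) → Gate k σ → Gate k σ := fun f g => match g with
    | .sum args => .sum (args.map fun a => (a.1, f a.2)) | .prod args => .prod (args.map f)
  let B : ℕ → Gate k σ → List (Gate k σ) := fun w g => match g with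
    | .sum args => [zeroGate, zeroGate, M (E 2) (.sum args),
        (if w = v then zeroGate else M (E 3) (.sum args)),
        (if w = v then .sum [(1, .const 1)] else .sum (args.map fun a => (a.1, H a.2)))]
    | .prod args => [.prod [H (args.getD 0 (.const 1)), E 2 (args.getD 1 (.const 1))],
        .prod [E 3 (args.getD 0 (.const 1)), H (args.getD 1 (.const 1))],
        M (E 2) (.prod args), (if w = v then zeroGate else M (E 3) (.prod args)),
        (if w = v then .sum [(1, .const 1)]
          else .sum [(1, .gate (5 * w)), (1, .gate (5 * w + 1))])]
  obtain ⟨hlen, -, -, hA4⟩ := link_invariant (E := E) (H := H) (M := M) (B := B) (v := v)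
    (fun _ _ => rfl) (fun _ _ => rfl) (fun _ _ => rfl) (fun _ => rfl) (fun _ => rfl) (fun _ => rfl)
    (fun _ _ => rfl) (fun _ _ => rfl) (fun _ _ => rfl) (fun _ _ => rfl)
    ((gateValues P.gates).getD v 0) P.gates hP fun _ => rfl
  refine ⟨⟨(P.gates.mapIdx B).flatten, H P.output⟩, fun g' hg' => ?_, ?_,
    eval_H (H := H) (fun _ => rfl) (fun _ => rfl) (fun _ => rfl) hA4 P.output⟩
  · obtain ⟨l, hl, hg'l⟩ := List.mem_flatten.1 hg'
    obtain ⟨i, hi, rfl⟩ := List.mem_mapIdx.1 hl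
    exact fanIn_of_mem_B (E := E) (H := H) (M := M) (B := B) (v := v) (fun _ _ => rfl)
      (fun _ _ => rfl) (fun _ _ => rfl) (fun _ _ => rfl) (hP _ (List.getElem_mem hi)) hg'l
  · show ((P.gates.mapIdx B).flatten).length ≤ 8 * P.gates.length + 8
    rw [hlen]; omega

/-- **Registered stub `stub_linkCircuit` — the complement factor of a peel is cheap.** For a
fan-in-two circuit `P` over `ℝ≥0` and a gate index `v` there is a fan-in-two circuit `Q` with at
most `8 · size P + 8` gates (in fact `5 · size P`) and `P.eval = (P.zeroAt v).eval + p_v · Q.eval`,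
`p_v = (gateValues P.gates).getD v 0`. [cite: JerrumSnir1982, §3.1 (Lemma 3.1(iii))] -/
theorem stub_linkCircuit : ∀ (σ : Type) (P : ArithCircuit ℝ≥0 σ) (v : ℕ), P.IsFanInTwo →
    ∃ Q : ArithCircuit ℝ≥0 σ, Q.IsFanInTwo ∧ Q.size ≤ 8 * P.size + 8 ∧
      P.eval = (P.zeroAt v).eval + (ArithCircuit.gateValues P.gates).getD v 0 * Q.eval :=
  fun _ P v hP => exists_linkCircuit P v hP

end Summit.ValiantsHypothesis.ValiantsHypothesis.Theorems.DivisionGap.PerMultiplesHard.LinkCircuit
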